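import Literature.NumberTheory.Transcendental.LinGroupK
import Literature.RingTheory.MvPolynomial.Directrix
import Mathlib.RingTheory.MvPolynomial.Homogeneous
import Mathlib.Algebra.MonoidAlgebra.Module
import Mathlib.Data.Nat.Factorial.Basic
import HarnessLib

/-!
# Taylor coefficients of the exponential polynomial of `P ∈ K[X, Y]` along a subspace of `Lie(𝔾ₐ^{d₀} × 𝔾ₘ^{d₁})`, and the invariant derivations

Topic `Literature/NumberTheory/Transcendental` (namespace `Literature.NumberTheory.Transcendental`,
grouping sub-namespace `LinGroupK`). Everything here is PROVED; definitions with bodies; no named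
facts. Pure commutative algebra over a field `K` of characteristic `0` (no norms, no `p`-adics).

This is the formal skeleton of the analytic half of the several-variable method of Gel'fond and
Schneider in its INTERPOLATION-FREE form ([Waldschmidt1988, §6 Prop. 6.1], after [15] there =
Waldschmidt, Invent. Math. 63 (1981), Prop. 2.4 / Thm 3.1: "one constructs the auxiliary
function directly small, by the box principle, on the Taylor coefficients"), organised so that
the `p`-adic case needs no function theory at all. Fix `n` and a "frame" `Φ = (A, B)`: linear
forms `Aᵢ(u) = ∑ₖ Aᵢₖ uₖ` (`i < d₀`) and `Bⱼ(u) = ∑ₖ Bⱼₖ uₖ` (`j < d₁`) on `K^n` — the coordinates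
of the parametrisation `u ↦ φ(u) = ∑ uₖ vₖ` of a subspace `V = Kv₁ + ⋯ + Kv_n` of
`Lie G = K^{d₀} × K^{d₁}`. The exponential polynomial of `R = ∑ r_s X^{s₀} Y^{s₁} ∈ K[X, Y]` along
`V` is `Φ_R(u) = ∑_s r_s A(u)^{s₀} exp(ℓ_s(u))`, `ℓ_s = ∑ⱼ s₁ⱼ Bⱼ`; its Taylor coefficients at
`u = 0` are the purely algebraic quantities

  `tc_κ(R) = coeff_κ ( ∑_s r_s · A^{s₀} · E_M(ℓ_s) )`,  `E_M(ℓ) = ∑_{ν<M} ℓ^ν/ν!`,  any `M > |κ|`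

(`LinGroupK.taylorCoeff`, through the linear map `LinGroupK.genPoly Φ M : K[X,Y] → K[u]`,
`R ↦ ∑_s r_s A^{s₀} E_M(ℓ_s)`; independence of `M`: `coeff_genPoly_eq_taylorCoeff`). The main
result is the **derivation identity** (`taylorCoeff_invDeriv`): for `w = φ(w̃) ∈ V`,

  `tc_κ(D_w R) = ∑ₖ w̃ₖ (κₖ + 1) tc_{κ+eₖ}(R)`,

i.e. the invariant derivation `D_w` on `K[X, Y]` (`LinGroupK.invDeriv`) is the directional
derivative `∂_{w̃}` on Taylor coefficients — the algebraic content of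
"`d/dt P(g exp_G(v + tw)) = (D_w P)(g exp_G(v + tw))`" ([NesterenkoPhilippon2001, Ch. 11, Lemma 3.1];
tree, over `ℂ`: `LinGroup.hasDerivAt_eval_flow`). It is proved from the exact polynomial identity
`∂ₖ ∘ genPoly_{M+1} = genPoly_{M+1} ∘ D^X_k + genPoly_M ∘ D^Y_k` (`pderiv_genPoly`), where
`D^X_k = ∑ᵢ Aᵢₖ ∂/∂Xᵢ`, `D^Y_k = ∑ⱼ Bⱼₖ Yⱼ∂/∂Yⱼ` (so that `D_{φ(w̃)} = ∑ₖ w̃ₖ (D^X_k + D^Y_k)`),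
checked on monomials with the product rule and `∂ E_{M+1}(ℓ) = (∂ℓ) E_M(ℓ)`.

## References

* [Waldschmidt1988] M. Waldschmidt, *On the transcendence methods of Gel'fond and Schneider in
  several variables*, New Advances in Transcendence Theory (A. Baker ed.), CUP 1988, 375–398, §6
  (Proposition 6.1 and the reference to [15], Prop. 2.4).
* [NesterenkoPhilippon2001] Yu. V. Nesterenko, P. Philippon (eds.), *Introduction to Algebraic
  Independence Theory*, LNM 1752, Springer 2001, Ch. 11 (D. Roy), §3, Lemma 3.1.
-/

noncomputable section

open MvPolynomial Finset
open Literature.RingTheory.MvPolynomial (linForm linForm_apply isHomogeneous_linForm)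

namespace Literature.NumberTheory.Transcendental

namespace LinGroupK

variable {K : Type*} [Field K] {n d₀ d₁ : ℕ}

/-! ### Linear forms on `K^n` as polynomials

The linear form `u ↦ ∑ₖ cₖ uₖ` as an element of `K[u₁, …, u_n]` is the tree's
`Literature.RingTheory.MvPolynomial.linForm c = ∑ₖ cₖ • Xₖ` (`Directrix.lean`; a `K`-linear map in
`c`, homogeneous of degree `1`: `isHomogeneous_linForm`); two more unfolding lemmas. -/

/-- `∂ₖ (∑ cₖ uₖ) = cₖ`. [folklore] -/
@[simp] theorem pderiv_linForm (k : Fin n) (c : Fin n → K) :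
    pderiv k (linForm c : MvPolynomial (Fin n) K) = C (c k) := by
  classical
  rw [linForm_apply, map_sum]
  simp_rw [Derivation.map_smul, pderiv_X]
  rw [Finset.sum_eq_single k (fun k' _ hk' => by simp [hk']) (by simp)]
  simp [smul_eq_C_mul]

/-- Value of a linear form. [folklore] -/
theorem eval_linForm (u c : Fin n → K) : eval u (linForm c : MvPolynomial (Fin n) K) = ∑ k, c k * u k := by
  simp [linForm_apply, map_sum, smul_eval]

/-! ### Frames: the coordinates of a parametrised subspace of `Lie G` -/

variable (K n d₀ d₁) in
/-- A **frame**: the coefficients of the linear forms `Aᵢ(u) = ∑ₖ Aᵢₖuₖ` (`i < d₀`, additive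
coordinates) and `Bⱼ(u) = ∑ₖ Bⱼₖuₖ` (`j < d₁`, multiplicative coordinates) of a linear
parametrisation `u ↦ φ(u)` of a subspace of `Lie G = K^{d₀} × K^{d₁}` by `K^n`
(`φ(u) = (A(u), B(u))`; for `φ(u) = ∑ₖ uₖ vₖ`, `Aᵢₖ = (vₖ)₀ᵢ`, `Bⱼₖ = (vₖ)₁ⱼ`).
[cite: Waldschmidt1988, §6 (p. 389)] -/
structure Frame where
  /-- coefficients of the additive coordinate forms -/
  A : Fin d₀ → Fin n → K
  /-- coefficients of the multiplicative coordinate forms -/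
  B : Fin d₁ → Fin n → K

namespace Frame

variable (Φ : Frame K n d₀ d₁)

/-- The parametrisation `φ(w̃) = (A(w̃), B(w̃)) ∈ Lie G` of the tangent vector with coordinates `w̃`.
[folklore] -/
def vec (c : Fin n → K) : (Fin d₀ → K) × (Fin d₁ → K) :=
  (fun i => ∑ k, c k * Φ.A i k, fun j => ∑ k, c k * Φ.B j k)

/-- `φ` is additive. [folklore] -/
theorem vec_add (c c' : Fin n → K) : Φ.vec (c + c') = Φ.vec c + Φ.vec c' := by
  ext <;> simp [vec, add_mul, Finset.sum_add_distrib]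

/-- `φ` is homogeneous. [folklore] -/
theorem vec_smul (a : K) (c : Fin n → K) : Φ.vec (a • c) = a • Φ.vec c := by
  ext <;> simp [vec, Finset.mul_sum, mul_assoc]

/-- `φ(eₖ) = ((Aᵢₖ)ᵢ, (Bⱼₖ)ⱼ)`. [folklore] -/
theorem vec_single (k : Fin n) : Φ.vec (Pi.single k 1) = (fun i => Φ.A i k, fun j => Φ.B j k) := by
  ext i
  · simp only [vec]
    rw [Finset.sum_eq_single k (fun k' _ hk' => by simp [hk']) (by simp)]
    simp
  · simp only [vec]
    rw [Finset.sum_eq_single k (fun k' _ hk' => by simp [hk']) (by simp)]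
    simp

/-- `c = ∑ₖ cₖ eₖ`, hence `φ(c) = ∑ₖ cₖ φ(eₖ)`. [folklore] -/
theorem vec_eq_sum (c : Fin n → K) : Φ.vec c = ∑ k, c k • Φ.vec (Pi.single k 1) := by
  have hc : c = ∑ k, c k • (Pi.single k (1 : K) : Fin n → K) := by
    ext i
    simp [Finset.sum_apply, Pi.single_apply]
  conv_lhs => rw [hc]
  induction (Finset.univ : Finset (Fin n)) using Finset.induction_on with
  | empty =>
    simp only [Finset.sum_empty]
    ext <;> simp [vec]
  | insert a s ha ih => rw [Finset.sum_insert ha, Finset.sum_insert ha, vec_add, vec_smul, ih]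

/-- The monomial `A^{s₀} = ∏ᵢ Aᵢ^{s₀ᵢ}` in the additive forms. [folklore] -/
def monoX (s : Fin d₀ ⊕ Fin d₁ →₀ ℕ) : MvPolynomial (Fin n) K :=
  ∏ i, linForm (Φ.A i) ^ s (Sum.inl i)

/-- The linear form `ℓ_s = ∑ⱼ s₁ⱼ Bⱼ` (the exponent of `Y^{s₁}` along the frame). [folklore] -/
def formL (s : Fin d₀ ⊕ Fin d₁ →₀ ℕ) : MvPolynomial (Fin n) K :=
  ∑ j, C ((s (Sum.inr j) : ℕ) : K) * linForm (Φ.B j)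

/-- `ℓ_s` is homogeneous of degree `1`. [folklore] -/
theorem formL_isHomogeneous (s : Fin d₀ ⊕ Fin d₁ →₀ ℕ) : (Φ.formL s).IsHomogeneous 1 :=
  IsHomogeneous.sum _ _ _ fun _ _ => (isHomogeneous_linForm _).C_mul _

/-- `ℓ_s` only depends on the `Y`-exponents: lowering an `X`-exponent does not change it.
[folklore] -/
theorem formL_sub_single_inl (s : Fin d₀ ⊕ Fin d₁ →₀ ℕ) (i : Fin d₀) :
    Φ.formL (s - Finsupp.single (Sum.inl i) 1) = Φ.formL s := by
  simp [formL]

/-- `∂ₖ ℓ_s = ∑ⱼ s₁ⱼ Bⱼₖ`. [folklore] -/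
theorem pderiv_formL (k : Fin n) (s : Fin d₀ ⊕ Fin d₁ →₀ ℕ) :
    pderiv k (Φ.formL s) = C (∑ j, ((s (Sum.inr j) : ℕ) : K) * Φ.B j k) := by
  rw [formL, map_sum, map_sum]
  refine Finset.sum_congr rfl fun j _ => ?_
  rw [pderiv_C_mul, pderiv_linForm, ← map_mul]

/-- **Product rule for `A^{s₀}`**: `∂ₖ A^{s₀} = ∑ᵢ s₀ᵢ Aᵢₖ A^{s₀ − eᵢ}`. [folklore] -/
theorem pderiv_monoX (k : Fin n) (s : Fin d₀ ⊕ Fin d₁ →₀ ℕ) :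
    pderiv k (Φ.monoX s) =
      ∑ i, C (((s (Sum.inl i) : ℕ) : K) * Φ.A i k) * Φ.monoX (s - Finsupp.single (Sum.inl i) 1) := by
  classical
  -- general product rule over a finset, by induction
  have key : ∀ t : Finset (Fin d₀), pderiv k (∏ i ∈ t, linForm (Φ.A i) ^ s (Sum.inl i)) =
      ∑ i ∈ t, C (((s (Sum.inl i) : ℕ) : K) * Φ.A i k) *
        ((linForm (Φ.A i)) ^ (s (Sum.inl i) - 1) *
          ∏ i' ∈ t.erase i, linForm (Φ.A i') ^ s (Sum.inl i')) := by
    intro t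
    induction t using Finset.induction_on with
    | empty => simp
    | insert a t ha ih =>
      rw [Finset.prod_insert ha, pderiv_mul, ih, Finset.sum_insert ha, Finset.erase_insert ha]
      congr 1
      · rw [pderiv_pow, pderiv_linForm, map_mul, map_natCast]
        ring
      · rw [Finset.mul_sum]
        refine Finset.sum_congr rfl fun i hi => ?_
        have hia : i ≠ a := fun h => ha (h ▸ hi)
        rw [Finset.erase_insert_of_ne hia.symm, Finset.prod_insert (fun h => ha (Finset.mem_of_mem_erase h))]
        ring
  rw [monoX, key]
  refine Finset.sum_congr rfl fun i _ => ?_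
  congr 1
  rw [monoX, ← Finset.mul_prod_erase Finset.univ _ (Finset.mem_univ i)]
  congr 1
  · simp
  · refine Finset.prod_congr rfl fun i' hi' => ?_
    rw [Finset.mem_erase] at hi'
    simp [Ne.symm hi'.1]

end Frame

/-! ### Truncated exponentials -/

/-- The truncated exponential `E_M(ℓ) = ∑_{ν<M} ℓ^ν/ν!`. [folklore] -/
def truncExp (M : ℕ) (ℓ : MvPolynomial (Fin n) K) : MvPolynomial (Fin n) K :=
  ∑ ν ∈ Finset.range M, C ((ν.factorial : K)⁻¹) * ℓ ^ ν

/-- `E_0 = 0`. [folklore] -/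
@[simp] theorem truncExp_zero (ℓ : MvPolynomial (Fin n) K) : truncExp 0 ℓ = 0 := by
  simp [truncExp]

/-- **`∂ E_{M+1}(ℓ) = (∂ℓ) · E_M(ℓ)`** (characteristic `0`). [folklore] -/
theorem pderiv_truncExp_succ [CharZero K] (k : Fin n) (M : ℕ) (ℓ : MvPolynomial (Fin n) K) :
    pderiv k (truncExp (M + 1) ℓ) = pderiv k ℓ * truncExp M ℓ := by
  rw [truncExp, truncExp, map_sum, Finset.sum_range_succ', Finset.mul_sum]
  simp only [pow_zero, pderiv_C_mul, Derivation.map_one_eq_zero, mul_zero, add_zero]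
  refine Finset.sum_congr rfl fun ν _ => ?_
  rw [pderiv_pow, Nat.add_sub_cancel]
  have hν : ((ν.factorial : K)) ≠ 0 := by exact_mod_cast ν.factorial_ne_zero
  have hν1 : (((ν + 1 : ℕ) : K)) ≠ 0 := by exact_mod_cast Nat.succ_ne_zero ν
  rw [Nat.factorial_succ, Nat.cast_mul]
  rw [show (C (((ν + 1 : ℕ) : K) * (ν.factorial : K))⁻¹ : MvPolynomial (Fin n) K) *
      ((((ν + 1 : ℕ) : MvPolynomial (Fin n) K)) * ℓ ^ ν * pderiv k ℓ) =
      (C (((ν + 1 : ℕ) : K) * (ν.factorial : K))⁻¹ * C (((ν + 1 : ℕ) : K))) * ℓ ^ ν * pderiv k ℓ by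
    rw [map_natCast]; ring]
  rw [← map_mul, mul_inv_rev, mul_assoc (((ν.factorial : K))⁻¹), inv_mul_cancel₀ hν1, mul_one]
  ring

/-- Splitting a longer truncation: `E_{M+N}(ℓ) = E_M(ℓ) + ∑_{M ≤ ν < M+N} ℓ^ν/ν!`. [folklore] -/
theorem truncExp_add (M N : ℕ) (ℓ : MvPolynomial (Fin n) K) :
    truncExp (M + N) ℓ = truncExp M ℓ + ∑ ν ∈ Finset.Ico M (M + N), C ((ν.factorial : K)⁻¹) * ℓ ^ ν := by
  rw [truncExp, truncExp, Finset.range_eq_Ico, Finset.range_eq_Ico,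
    ← Finset.sum_Ico_consecutive _ (Nat.zero_le M) (Nat.le_add_right M N)]

/-! ### Coefficients below the degree of a homogeneous factor vanish -/

/-- If `ψ` is homogeneous of degree `ν > |κ|` then `coeff_κ(φ ψ) = 0`. [folklore] -/
theorem coeff_mul_eq_zero_of_isHomogeneous {φ ψ : MvPolynomial (Fin n) K} {ν : ℕ}
    (hψ : ψ.IsHomogeneous ν) {κ : Fin n →₀ ℕ} (hκ : κ.degree < ν) : coeff κ (φ * ψ) = 0 := by
  classical
  rw [coeff_mul]
  refine Finset.sum_eq_zero fun x hx => ?_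
  rw [Finset.mem_antidiagonal] at hx
  have hx2 : x.2.degree ≤ κ.degree := by
    rw [← hx, map_add]
    exact Nat.le_add_left _ _
  rw [hψ.coeff_eq_zero (by omega), mul_zero]

/-- The terms `ℓ^ν/ν!`, `ν ≥ M > |κ|`, of a truncated exponential do not contribute to `coeff_κ`.
[folklore] -/
theorem coeff_mul_truncExp_eq (φ ℓ : MvPolynomial (Fin n) K) (hℓ : ℓ.IsHomogeneous 1)
    {κ : Fin n →₀ ℕ} {M N : ℕ} (hM : κ.degree < M) :
    coeff κ (φ * truncExp (M + N) ℓ) = coeff κ (φ * truncExp M ℓ) := by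
  rw [truncExp_add, mul_add, coeff_add, Finset.mul_sum, coeff_sum]
  rw [Finset.sum_eq_zero fun ν hν => ?_, add_zero]
  rw [Finset.mem_Ico] at hν
  rw [← mul_assoc]
  refine coeff_mul_eq_zero_of_isHomogeneous (by simpa using hℓ.pow ν) ?_
  omega

/-! ### The generating polynomial and the Taylor coefficients -/

namespace Frame

variable (Φ : Frame K n d₀ d₁)

/-- **The generating polynomial** `genPoly Φ M R = ∑_s r_s · A^{s₀} · E_M(ℓ_s) ∈ K[u]` of
`R = ∑_s r_s X^{s₀}Y^{s₁}` along the frame (the Taylor expansion of `∑ r_s A(u)^{s₀} exp(ℓ_s(u))`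
with each exponential truncated at order `M`), as a `K`-linear map in `R`.
[cite: Waldschmidt1988, §6 (p. 389)] -/
def genPoly (M : ℕ) : MvPolynomial (Fin d₀ ⊕ Fin d₁) K →ₗ[K] MvPolynomial (Fin n) K :=
  (Finsupp.lsum K fun s : Fin d₀ ⊕ Fin d₁ →₀ ℕ =>
      LinearMap.toSpanSingleton K (MvPolynomial (Fin n) K) (Φ.monoX s * truncExp M (Φ.formL s))) ∘ₗ
    (AddMonoidAlgebra.coeffLinearEquiv K).toLinearMap

/-- `genPoly` on a monomial. [folklore] -/
@[simp] theorem genPoly_monomial (M : ℕ) (s : Fin d₀ ⊕ Fin d₁ →₀ ℕ) (a : K) :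
    Φ.genPoly M (monomial s a) = a • (Φ.monoX s * truncExp M (Φ.formL s)) := by
  rw [genPoly, LinearMap.comp_apply]
  change (Finsupp.lsum K fun s : Fin d₀ ⊕ Fin d₁ →₀ ℕ =>
      LinearMap.toSpanSingleton K (MvPolynomial (Fin n) K) (Φ.monoX s * truncExp M (Φ.formL s)))
      (Finsupp.single s a) = _
  rw [Finsupp.lsum_single]
  rfl

/-- **The Taylor coefficient** `tc_κ(R) = coeff_κ(genPoly Φ (|κ|+1) R)` (a `K`-linear functional of
`R`; any truncation order `> |κ|` gives the same value, `coeff_genPoly_eq_taylorCoeff`).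
[cite: Waldschmidt1988, §6 (p. 389)] -/
def taylorCoeff (κ : Fin n →₀ ℕ) : MvPolynomial (Fin d₀ ⊕ Fin d₁) K →ₗ[K] K :=
  lcoeff K κ ∘ₗ Φ.genPoly (κ.degree + 1)

/-- Unfolding `taylorCoeff`. [folklore] -/
theorem taylorCoeff_apply (κ : Fin n →₀ ℕ) (R : MvPolynomial (Fin d₀ ⊕ Fin d₁) K) :
    Φ.taylorCoeff κ R = coeff κ (Φ.genPoly (κ.degree + 1) R) := rfl

/-- **Independence of the truncation order**: `coeff_κ(genPoly Φ M R) = tc_κ(R)` for every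
`M > |κ|`. [folklore] -/
theorem coeff_genPoly_eq_taylorCoeff (κ : Fin n →₀ ℕ) {M : ℕ} (hM : κ.degree < M)
    (R : MvPolynomial (Fin d₀ ⊕ Fin d₁) K) : coeff κ (Φ.genPoly M R) = Φ.taylorCoeff κ R := by
  -- both sides are linear in `R`: check on monomials
  suffices h : lcoeff K κ ∘ₗ Φ.genPoly M = Φ.taylorCoeff κ from LinearMap.congr_fun h R
  refine MvPolynomial.linearMap_ext fun s => LinearMap.ext_ring ?_
  simp only [LinearMap.comp_apply, taylorCoeff, genPoly_monomial, lcoeff_apply, one_smul]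
  obtain ⟨N, rfl⟩ : ∃ N, M = (κ.degree + 1) + N := ⟨M - (κ.degree + 1), by omega⟩
  exact coeff_mul_truncExp_eq _ _ (Φ.formL_isHomogeneous s) (Nat.lt_succ_self _)

/-! ### The invariant derivations through the frame -/

/-- `D^X_k = ∑ᵢ Aᵢₖ ∂/∂Xᵢ`: the additive part of `D_{φ(eₖ)}`. [folklore] -/
def DX (k : Fin n) : Derivation K (MvPolynomial (Fin d₀ ⊕ Fin d₁) K) (MvPolynomial (Fin d₀ ⊕ Fin d₁) K) :=
  ∑ i : Fin d₀, Φ.A i k • pderiv (Sum.inl i)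

/-- `D^Y_k = ∑ⱼ Bⱼₖ Yⱼ ∂/∂Yⱼ`: the multiplicative part of `D_{φ(eₖ)}`. [folklore] -/
def DY (k : Fin n) : Derivation K (MvPolynomial (Fin d₀ ⊕ Fin d₁) K) (MvPolynomial (Fin d₀ ⊕ Fin d₁) K) :=
  ∑ j : Fin d₁, Φ.B j k • ((X (Sum.inr j) : MvPolynomial (Fin d₀ ⊕ Fin d₁) K) • pderiv (Sum.inr j))

/-- `D_{φ(eₖ)} = D^X_k + D^Y_k`. [folklore] -/
theorem invDeriv_vec_single (k : Fin n) : invDeriv (Φ.vec (Pi.single k 1)) = Φ.DX k + Φ.DY k := by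
  rw [vec_single, invDeriv, DX, DY]

/-- `D^X_k` on a monomial: `D^X_k X^s = ∑ᵢ sᵢ Aᵢₖ X^{s−eᵢ}`. [folklore] -/
theorem DX_monomial (k : Fin n) (s : Fin d₀ ⊕ Fin d₁ →₀ ℕ) (a : K) :
    Φ.DX k (monomial s a) =
      ∑ i, monomial (s - Finsupp.single (Sum.inl i) 1) (a * (s (Sum.inl i) : K) * Φ.A i k) := by
  rw [DX, sum_derivation_apply]
  refine Finset.sum_congr rfl fun i _ => ?_
  rw [Derivation.smul_apply, pderiv_monomial, smul_monomial, smul_eq_mul]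
  congr 1
  ring

/-- `D^Y_k` on a monomial: `D^Y_k X^s = (∑ⱼ s₁ⱼ Bⱼₖ) X^s`. [folklore] -/
theorem DY_monomial (k : Fin n) (s : Fin d₀ ⊕ Fin d₁ →₀ ℕ) (a : K) :
    Φ.DY k (monomial s a) = monomial s (a * ∑ j, ((s (Sum.inr j) : ℕ) : K) * Φ.B j k) := by
  classical
  rw [DY, sum_derivation_apply, Finset.mul_sum, map_sum]
  refine Finset.sum_congr rfl fun j _ => ?_
  rw [Derivation.smul_apply, Derivation.smul_apply, pderiv_monomial, smul_eq_mul,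
    show (X (Sum.inr j) : MvPolynomial (Fin d₀ ⊕ Fin d₁) K) = monomial (Finsupp.single (Sum.inr j) 1) 1
      from rfl, monomial_mul, one_mul, smul_monomial, smul_eq_mul]
  by_cases hj : s (Sum.inr j) = 0
  · simp [hj]
  · have hs : Finsupp.single (Sum.inr j) 1 + (s - Finsupp.single (Sum.inr j) 1) = s := by
      ext v
      simp only [Finsupp.coe_add, Pi.add_apply, Finsupp.coe_tsub, Pi.sub_apply, Finsupp.single_apply]
      split_ifs with h
      · subst h; omega
      · simp
    rw [hs]
    congr 1
    ring

/-- **The derivation identity on generating polynomials** (exact):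
`∂ₖ (genPoly_{M+1} R) = genPoly_{M+1} (D^X_k R) + genPoly_M (D^Y_k R)`.
[cite: NesterenkoPhilippon2001, Ch. 11 Lemma 3.1] -/
theorem pderiv_genPoly [CharZero K] (k : Fin n) (M : ℕ) (R : MvPolynomial (Fin d₀ ⊕ Fin d₁) K) :
    pderiv k (Φ.genPoly (M + 1) R) = Φ.genPoly (M + 1) (Φ.DX k R) + Φ.genPoly M (Φ.DY k R) := by
  classical
  -- linear in `R`: check on monomials
  induction R using MvPolynomial.induction_on' with
  | add p q hp hq => simp only [map_add, hp, hq]; abel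
  | monomial s a =>
    rw [genPoly_monomial, Derivation.map_smul, DX_monomial, DY_monomial, map_sum, Derivation.leibniz,
      smul_eq_mul, smul_eq_mul, pderiv_truncExp_succ, pderiv_formL, pderiv_monoX]
    -- the `X`-part
    have hX : ∑ i, Φ.genPoly (M + 1) (monomial (s - Finsupp.single (Sum.inl i) 1)
        (a * ((s (Sum.inl i) : ℕ) : K) * Φ.A i k)) =
        C a * ((∑ i, C (((s (Sum.inl i) : ℕ) : K) * Φ.A i k) * Φ.monoX (s - Finsupp.single (Sum.inl i) 1)) *
          truncExp (M + 1) (Φ.formL s)) := by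
      rw [Finset.sum_mul, Finset.mul_sum]
      refine Finset.sum_congr rfl fun i _ => ?_
      rw [genPoly_monomial, formL_sub_single_inl, smul_eq_C_mul, mul_assoc a, map_mul]
      ring
    rw [hX, genPoly_monomial]
    simp only [smul_eq_C_mul, map_mul]
    ring

/-- **The derivation identity on Taylor coefficients, one coordinate direction**:
`tc_κ(D_{φ(eₖ)} R) = (κₖ + 1) · tc_{κ+eₖ}(R)`. [cite: NesterenkoPhilippon2001, Ch. 11 Lemma 3.1] -/
theorem taylorCoeff_invDeriv_single [CharZero K] (k : Fin n) (κ : Fin n →₀ ℕ)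
    (R : MvPolynomial (Fin d₀ ⊕ Fin d₁) K) :
    Φ.taylorCoeff κ (invDeriv (Φ.vec (Pi.single k 1)) R) =
      ((κ k : ℕ) + 1 : K) * Φ.taylorCoeff (κ + Finsupp.single k 1) R := by
  have hdeg : (κ + Finsupp.single k 1).degree = κ.degree + 1 := by
    rw [map_add, Finsupp.degree_single]
  rw [invDeriv_vec_single, Derivation.add_apply, map_add,
    ← Φ.coeff_genPoly_eq_taylorCoeff κ (M := κ.degree + 2) (by omega),
    ← Φ.coeff_genPoly_eq_taylorCoeff κ (M := κ.degree + 1) (by omega),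
    ← Φ.coeff_genPoly_eq_taylorCoeff (κ + Finsupp.single k 1) (M := κ.degree + 2) (by omega),
    ← coeff_add, ← pderiv_genPoly, coeff_pderiv]
  ring

/-- **The derivation identity on Taylor coefficients**: for `w = φ(w̃)`,
`tc_κ(D_w R) = ∑ₖ w̃ₖ (κₖ + 1) tc_{κ+eₖ}(R)` — on Taylor coefficients along the frame, the invariant
derivation `D_w` is the directional derivative `∂_{w̃}`.
[cite: NesterenkoPhilippon2001, Ch. 11 Lemma 3.1] [cite: Waldschmidt1988, §6 (p. 389)] -/
theorem taylorCoeff_invDeriv [CharZero K] (c : Fin n → K) (κ : Fin n →₀ ℕ)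
    (R : MvPolynomial (Fin d₀ ⊕ Fin d₁) K) :
    Φ.taylorCoeff κ (invDeriv (Φ.vec c) R) =
      ∑ k, c k * (((κ k : ℕ) + 1 : K) * Φ.taylorCoeff (κ + Finsupp.single k 1) R) := by
  rw [vec_eq_sum]
  have : invDeriv (d₀ := d₀) (d₁ := d₁) (∑ k, c k • Φ.vec (Pi.single k 1)) =
      ∑ k, c k • invDeriv (Φ.vec (Pi.single k 1)) := by
    induction (Finset.univ : Finset (Fin n)) using Finset.induction_on with
    | empty => simp
    | insert a s ha ih => rw [Finset.sum_insert ha, Finset.sum_insert ha, invDeriv_add, invDeriv_smul, ih]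
  rw [this, sum_derivation_apply, map_sum]
  refine Finset.sum_congr rfl fun k _ => ?_
  rw [Derivation.smul_apply, map_smul, smul_eq_mul, taylorCoeff_invDeriv_single]

end Frame

end LinGroupK

end Literature.NumberTheory.Transcendental
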